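import Summits.QuantumFields.YangMills.Theorems.FemtoCurvatureSkewness.Negative.FalseOfUniformZeros

/-!
# `FemtoCurvatureSkewness` — what the TYPED `∀ a` crux claims in the infrared (positive consequences, kernel-checked)

Crux `stmt-QuantumFields-9365` (`LangevinControlUV.FemtoCurvatureSkewness`), lead c2 of line `coupling-cubic-response`
(prover-line-stmt-QuantumFields-9365-c2-0, 2026-08-16), `--supports stmt-QuantumFields-9365`.  Forward (planner-facing) forms of
the landed negative lemma `FemtoCurvatureSkewness_false_of_UniformZeros` (p93228) and of `twoPointPackage_wild` (p92533):

* `exists_twoPointPackage_of_uniformities`: for ANY compact `G` and `r`, the five covariance uniformities of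
  `Negative/WildPackage.lean` above a coupling `βu` (POS, UNIF-L, UNIF-B, UNIF-B', UNIF-O — thermodynamic-limit / weak-coupling
  regularity of plaquette covariances, no ultraviolet content) ALREADY produce a unit map carrying the two-point package of
  `FemtoCurvatureTwoPoint` (a wild map below `e^{-β}`): the typed hypothesis of the crux is met without any UV engine.
* `kappa3_ne_zero_of_femtoCurvatureSkewness`: consequently the TYPED crux asserts, for every compact simple `G` and every `r`
  whose covariances are uniform in that sense, GLOBAL eventual non-vanishing of the cumulant:
  `∃ β₁, ∀ β ≥ β₁, ∀ L ≥ 8n, n ≥ 1: κ₃(L, β, n) ≠ 0` — in ALL volumes, with no relation between `L`, `n` and `β`, i.e. deep in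
  the confined regime as well.  This is the a-free infrared statement (stub S `GlobalSkewSign` up to sign) that no ultraviolet line
  can supply and that the route's assembly never consumes (`yangMills_of_R1`, `…R1Assembly.lean`): the surplus of the `∀ a` shell
  over the ∃-bundled form `SkewnessForPackageMap`.

Nothing is asserted: both theorems are implications from explicit hypotheses.
-/

set_option autoImplicit false

noncomputable section

namespace Summit.QuantumFields.YangMills.Theorems.FemtoCurvatureSkewness.Negative

open MeasureTheory Filter Topology Function
open Literature.MathematicalPhysics.QuantumFieldTheory
open Summit.QuantumFields.YangMills.Theses.LangevinControlUV (FemtoCurvatureSkewness)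

section Package

variable {G : Type} [Group G] [TopologicalSpace G] [IsTopologicalGroup G] [CompactSpace G]
  [MeasurableSpace G] [BorelSpace G]

/-- **Uniform covariances already carry the two-point package** (no UV input): under POS, UNIF-L, UNIF-B, UNIF-B', UNIF-O above
`βu` there is a unit map `a ≤ e^{-β}` with `TwoPointPackage r a` (the wild map of `twoPointPackage_wild` for the envelope
`g = e^{-β}`). -/
theorem exists_twoPointPackage_of_uniformities (r : LatticeRep G) {βu K : ℝ} (hK : 1 ≤ K)
    (hPOS : ∀ (L : ℕ) [NeZero L] (β : ℝ) (n : ℕ), βu ≤ β → 1 ≤ n → 8 * n ≤ L →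
      0 < wCov r L β (plaq r L 0 0 1) (plaq r L (Pi.single (2 : Fin 4) ((n : ℕ) : ZMod L)) 0 1))
    (hUL : ∀ (L L' : ℕ) [NeZero L] [NeZero L'] (β : ℝ) (n : ℕ), βu ≤ β → 1 ≤ n → 8 * n ≤ L → 8 * n ≤ L' →
      wCov r L β (plaq r L 0 0 1) (plaq r L (Pi.single (2 : Fin 4) ((n : ℕ) : ZMod L)) 0 1) ≤
        K * wCov r L' β (plaq r L' 0 0 1) (plaq r L' (Pi.single (2 : Fin 4) ((n : ℕ) : ZMod L')) 0 1))
    (hUB : ∀ (L : ℕ) [NeZero L] (β : ℝ) (n : ℕ), βu ≤ β → 1 ≤ n → 8 * n ≤ L →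
      (n : ℝ) ^ 8 * wCov r L β (plaq r L 0 0 1) (plaq r L (Pi.single (2 : Fin 4) ((n : ℕ) : ZMod L)) 0 1) ≤ K)
    (hUB' : ∀ (L : ℕ) [NeZero L] (β : ℝ) (x y : Site 4 L) (i j i' j' : Fin 4), βu ≤ β → x ≠ y → i ≠ j →
      i' ≠ j' → |wCov r L β (plaq r L x i j) (plaq r L y i' j')| * torusDist L x y ^ 8 ≤ K)
    (hUO : ∀ (L L' : ℕ) [NeZero L] [NeZero L'] (β : ℝ) (n : ℕ) (x y : Site 4 L) (i j i' j' : Fin 4),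
      βu ≤ β → 1 ≤ n → 8 * n ≤ L' → x ≠ y → i ≠ j → i' ≠ j' → torusDist L x y = n →
      |wCov r L β (plaq r L x i j) (plaq r L y i' j')| ≤
        K * wCov r L' β (plaq r L' 0 0 1) (plaq r L' (Pi.single (2 : Fin 4) ((n : ℕ) : ZMod L')) 0 1)) :
    ∃ a : ℝ → ℝ, (∀ β, a β ≤ Real.exp (-β)) ∧ TwoPointPackage r a := by
  obtain ⟨a, hPkg, hag⟩ := twoPointPackage_wild r hK hPOS hUL hUB hUB' hUO (fun β => Real.exp (-β))
    (fun β => Real.exp_pos _) Real.tendsto_exp_neg_atTop_nhds_zero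
  exact ⟨a, hag, hPkg⟩

end Package

/-- **What the typed crux claims in the infrared.**  If `FemtoCurvatureSkewness` holds as typed (`∀ a`), then for every compact
simple `G` and every lattice representation `r` whose torus plaquette covariances satisfy the five uniformities of
`Negative/WildPackage.lean` above some coupling `βu` (POS, UNIF-L, UNIF-B, UNIF-B', UNIF-O), the cumulant
`κ₃(P_0^{01}, P_{ne₂}^{01}, P_{ne₃}^{01})` is eventually GLOBALLY non-zero: `∃ β₁, ∀ β ≥ β₁, ∀ L ≥ 8n, ∀ n ≥ 1, κ₃(L,β,n) ≠ 0` — all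
volumes, all separations up to `L/8`, no femto guard.  (Contrapositive of `FemtoCurvatureSkewness_false_of_UniformZeros`: zeros
at arbitrarily large coupling would assemble into `UniformZeros`.) -/
theorem kappa3_ne_zero_of_femtoCurvatureSkewness : FemtoCurvatureSkewness → ∀ (G : Type) [Group G] [TopologicalSpace G] [IsTopologicalGroup G] [CompactSpace G], IsCompactSimpleLieGroup G → letI : MeasurableSpace G := borel G; haveI : BorelSpace G := ⟨rfl⟩; ∀ (r : LatticeRep G) (βu K : ℝ), 1 ≤ K → (∀ (L : ℕ) [NeZero L] (β : ℝ) (n : ℕ), βu ≤ β → 1 ≤ n → 8 * n ≤ L → 0 < wCov r L β (plaq r L 0 0 1) (plaq r L (Pi.single (2 : Fin 4) ((n : ℕ) : ZMod L)) 0 1)) → (∀ (L L' : ℕ) [NeZero L] [NeZero L'] (β : ℝ) (n : ℕ), βu ≤ β → 1 ≤ n → 8 * n ≤ L → 8 * n ≤ L' → wCov r L β (plaq r L 0 0 1) (plaq r L (Pi.single (2 : Fin 4) ((n : ℕ) : ZMod L)) 0 1) ≤ K * wCov r L' β (plaq r L' 0 0 1) (plaq r L' (Pi.single (2 : Fin 4)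 ((n : ℕ) : ZMod L')) 0 1)) → (∀ (L : ℕ) [NeZero L] (β : ℝ) (n : ℕ), βu ≤ β → 1 ≤ n → 8 * n ≤ L → (n : ℝ) ^ 8 * wCov r L β (plaq r L 0 0 1) (plaq r L (Pi.single (2 : Fin 4) ((n : ℕ) : ZMod L)) 0 1) ≤ K) → (∀ (L : ℕ) [NeZero L] (β : ℝ) (x y : Site 4 L) (i j i' j' : Fin 4), βu ≤ β → x ≠ y → i ≠ j → i' ≠ j' → |wCov r L β (plaq r L x i j) (plaq r L y i' j')| * torusDist L x y ^ 8 ≤ K) → (∀ (L L' : ℕ) [NeZero L] [NeZero L'] (β : ℝ) (n : ℕ) (x y : Site 4 L) (i j i' j' : Fin 4), βu ≤ β → 1 ≤ n → 8 * n ≤ L' → x ≠ y → i ≠ j → i' ≠ j' → torusDist L x y = n → |wCov r L β (plaq r L x i j) (plaq r L y i' j')| ≤ K * wCov r L' β (plaq r L' 0 0 1) (plaq r L' (Pi.single (2 : Fin 4) ((n : ℕ) : ZMod L')) 0 1)) → ∃ β₁ : ℝ, ∀ (L : ℕ) [NeZero L] (β : ℝ) (n : ℕ), β₁ ≤ β →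 1 ≤ n → 8 * n ≤ L → kappa3 r L β n ≠ 0 := by
  intro hcrux G _ _ _ _ hG
  letI : MeasurableSpace G := borel G
  haveI : BorelSpace G := ⟨rfl⟩
  intro r βu K hK hPOS hUL hUB hUB' hUO
  by_contra hno
  -- zeros at arbitrarily large coupling: for every `k : ℕ` an admissible zero with `β ≥ k`
  have hz : ∀ k : ℕ, ∃ (L : ℕ) (_ : NeZero L) (β : ℝ) (n : ℕ),
      (k : ℝ) ≤ β ∧ 1 ≤ n ∧ 8 * n ≤ L ∧ kappa3 r L β n = 0 := by
    intro k
    by_contra hk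
    apply hno
    refine ⟨k, fun L _ β n hβ hn h8 h0 => hk ⟨L, inferInstance, β, n, hβ, hn, h8, h0⟩⟩
  choose Lz iz βz nz hβ hn h8 h0 using hz
  have hβz : Tendsto βz atTop atTop :=
    tendsto_atTop_mono hβ tendsto_natCast_atTop_atTop
  have hU : UniformZeros :=
    ⟨G, _, _, _, _, hG, r, βu, K, hK, hPOS, hUL, hUB, hUB', hUO, βz, Lz, nz, hβz,
      fun k => ⟨iz k, hn k, h8 k, h0 k⟩⟩
  exact FemtoCurvatureSkewness_false_of_UniformZeros hU hcrux

end Summit.QuantumFields.YangMills.Theorems.FemtoCurvatureSkewness.Negative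

end
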